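import Summits.Ventures.YMGap.RobustBall.OneStateInvariant
import Literature.MathematicalPhysics.QuantumFieldTheory.WilsonAxisSymmetry
import HarnessLib

/-!
# Venture YMGap, track ROBUST-BALL — ONE STATE, step 13: covariance of the perturbed specifications under PERMUTATIONS OF
# THE LATTICE AXES; the one state of an axis-symmetric member is axis-symmetric

HONEST FRAMING. WHAT THIS IS: a venture file (cell `pub-ymgap`, track Y2 ROBUST-BALL, seat ds-3), the axis-permutation twin
of `PerturbedCovariance.lean`, on the DLR side (no torus limit used). GENERIC (any relabelling `e` of the links,
`U ↦ U ∘ e⁻¹` = Mathlib `MeasurableEquiv.arrowCongr' e (refl G)`): covariant kernels ⇒ `e`-stable DLR set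
(`Covariance.map_arrowCongr_mem_gibbsMeasures`); tilted product-Haar kernels with an `e`-covariant energy are `e`-covariant
(`Covariance.tilted_glueWith_map_arrowCongr`). AXIS PERMUTATIONS `π` (tree `edgePermZd`, `configPermZd`): a plaquette goes
to a plaquette with the same observable (`exists_plaquette_perm`; `Re tr` is blind to the orientation of the plane, tree
`plaquetteObs_swap`), so the boundary WILSON ACTION IS PERMUTATION COVARIANT on `ℤ^d` (`wilsonBoundaryAction_perm`; torus
twin: tree `wilsonAction_configPerm`), the tier-1 perturbed specification is covariant whenever the finite-volume
Hamiltonians are (`perturbedYM_map_configPermZd`), and ★ in the uniqueness regime THE ONE STATE IS INVARIANT UNDER EVERY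
AXIS PERMUTATION for such members (`oneState_permInvariant_of_perturbedMassGapAt`; Wilson, every `d`, `N`:
`oneState_permInvariant_of_massGapAt`). The adjoint-plaquette member is permutation covariant (`adjointWitness_perm`,
`plaquetteSupp_perm`): ★ the one state of the `SU(2)` Bhanot–Creutz mixed action at `β_W = 1/8`, `|t| ≤ 1/100` is invariant
under all `24` axis permutations (`su2_mixedAction_oneState_permInvariant`), on top of its translation invariance.
WHAT THIS IS NOT: reflections `x_k ↦ −x_k` (which reverse link orientations) are not treated; lattice statements only,
nothing about the continuum limit or the Clay Millennium problem.

References: H.-O. Georgii (2011), §5.1; E. Seiler, LNP 159 (1982), Ch. 1–2; the tree's `WilsonAxisSymmetry.lean`,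
`LatticeGaugeStaticPotentialProofs.lean` (§B); the track's `PerturbedCovariance.lean`, `OneStateInvariant.lean`.
-/

noncomputable section

open MeasureTheory Filter Function
open Literature.Probability.LatticeModels hiding configShift configShift_apply
open Literature.MathematicalPhysics.QuantumLattice
open Literature.MathematicalPhysics.QuantumFieldTheory hiding ZdEdge Site

namespace Summit.Ventures.YMGap.RobustBall

namespace Covariance

section Relabel

variable {d : ℕ} {G : Type*} [MeasurableSpace G]

/-- Relabelling evaluated. [folklore] -/
theorem arrowCongr'_refl_apply (e : ZdEdge d ≃ ZdEdge d) (U : LGConfig d G) (x : ZdEdge d) :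
    MeasurableEquiv.arrowCongr' e (MeasurableEquiv.refl G) U x = U (e.symm x) := rfl

/-- `(Λ' relabelled by e⁻¹) relabelled by e` is `Λ'`. [folklore] -/
theorem map_symm_map (e : ZdEdge d ≃ ZdEdge d) (Λ' : Finset (ZdEdge d)) :
    (Λ'.map e.symm.toEmbedding).map e.toEmbedding = Λ' := by
  rw [Finset.map_map]
  have h : e.symm.toEmbedding.trans e.toEmbedding = Function.Embedding.refl _ := by
    ext x : 1
    simp
  rw [h, Finset.map_refl]

/-- `(Λ relabelled by e) relabelled by e⁻¹` is `Λ`. [folklore] -/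
theorem map_map_symm (e : ZdEdge d ≃ ZdEdge d) (Λ : Finset (ZdEdge d)) :
    (Λ.map e.toEmbedding).map e.symm.toEmbedding = Λ := by
  rw [Finset.map_map]
  have h : e.toEmbedding.trans e.symm.toEmbedding = Function.Embedding.refl _ := by
    ext x : 1
    simp
  rw [h, Finset.map_refl]

/-- **Covariant kernels under a relabelling of the links ⇒ the image of a Gibbs measure is a Gibbs measure**
(Georgii 2011, §5.1). [folklore] -/
theorem map_arrowCongr_mem_gibbsMeasures {γ : Specification (ZdEdge d) G} (hγ : IsSpecification γ)
    (e : ZdEdge d ≃ ZdEdge d)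
    (hcov : ∀ (Λ : Finset (ZdEdge d)) (η : LGConfig d G),
      (γ Λ η).map (MeasurableEquiv.arrowCongr' e (MeasurableEquiv.refl G)) =
        γ (Λ.map e.toEmbedding) (MeasurableEquiv.arrowCongr' e (MeasurableEquiv.refl G) η))
    {μ : Measure (LGConfig d G)} (hμ : μ ∈ gibbsMeasures γ) :
    μ.map (MeasurableEquiv.arrowCongr' e (MeasurableEquiv.refl G)) ∈ gibbsMeasures γ := by
  set T := MeasurableEquiv.arrowCongr' e (MeasurableEquiv.refl G) with hT
  rw [mem_gibbsMeasures_iff] at hμ ⊢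
  haveI := hμ.isProbabilityMeasure
  refine ⟨Measure.isProbabilityMeasure_map T.measurable.aemeasurable, fun Λ' A hA => ?_⟩
  set Λ : Finset (ZdEdge d) := Λ'.map e.symm.toEmbedding with hΛ
  have hΛ' : Λ' = Λ.map e.toEmbedding := (map_symm_map e Λ').symm
  rw [lintegral_map (hγ.measurable_coe Λ' hA) T.measurable, Measure.map_apply T.measurable hA]
  have hpt : ∀ η : LGConfig d G, γ Λ' (T η) A = γ Λ η (T ⁻¹' A) := fun η => by
    rw [hΛ', ← hcov Λ η, Measure.map_apply T.measurable hA]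
  simp_rw [hpt]
  exact hμ.2 Λ _ (T.measurable hA)

end Relabel

section Tilted

variable {d : ℕ} {G : Type*} [Group G] [TopologicalSpace G] [IsTopologicalGroup G] [CompactSpace G]
  [MeasurableSpace G] [BorelSpace G] [SecondCountableTopology G]

/-- **Covariance of tilted product-Haar kernels under a relabelling of the links (integral form)**:
`φ' (U ∘ e⁻¹) = φ U` ⇒ `∫ F dγ^{φ'}_{eΛ}(· | η ∘ e⁻¹) = ∫ F(· ∘ e⁻¹) dγ^{φ}_Λ(· | η)`. [folklore] -/
theorem integral_tilted_glueWith_arrowCongr (φ φ' : LGConfig d G → ℝ) (hφc : Continuous φ) (hφc' : Continuous φ')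
    (Λ : Finset (ZdEdge d)) (e : ZdEdge d ≃ ZdEdge d)
    (hcov : ∀ U, φ' (MeasurableEquiv.arrowCongr' e (MeasurableEquiv.refl G) U) = φ U)
    {F : LGConfig d G → ℝ} (hF : Measurable F) (η : LGConfig d G) :
    ∫ U, F U ∂(((Measure.pi fun _ : ↥(Λ.map e.toEmbedding) => haarProbability G).map
        (glueWith (Λ.map e.toEmbedding) · (MeasurableEquiv.arrowCongr' e (MeasurableEquiv.refl G) η))).tilted φ') =
      ∫ U, F (MeasurableEquiv.arrowCongr' e (MeasurableEquiv.refl G) U)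
        ∂(((Measure.pi fun _ : ↥Λ => haarProbability G).map (glueWith Λ · η)).tilted φ) := by
  set T := MeasurableEquiv.arrowCongr' e (MeasurableEquiv.refl G) with hT
  set Λ' := Λ.map e.toEmbedding with hΛ'
  set eΛ : ↥Λ ≃ ↥Λ' := e.subtypeEquiv fun _ => (Finset.mem_map' e.toEmbedding).symm
  set Ψ : (↥Λ → G) ≃ᵐ (↥Λ' → G) := MeasurableEquiv.piCongrLeft (fun _ => G) eΛ
  have hΨm : MeasurePreserving Ψ.symm (Measure.pi fun _ : ↥Λ' => haarProbability G)
      (Measure.pi fun _ : ↥Λ => haarProbability G) :=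
    (measurePreserving_piCongrLeft (fun _ : ↥Λ' => haarProbability G) eΛ).symm Ψ
  -- gluing commutes with the relabelling
  have hglue : ∀ ζ' : ↥Λ' → G, T (glueWith Λ (Ψ.symm ζ') η) = glueWith Λ' ζ' (T η) := by
    intro ζ'
    funext x'
    rw [arrowCongr'_refl_apply]
    by_cases h' : x' ∈ Λ'
    · have h₀ : e.symm x' ∈ Λ := by rwa [hΛ', Finset.mem_map_equiv] at h'
      rw [glueWith_apply_mem _ _ _ h₀, glueWith_apply_mem _ _ _ h']
      change ζ' (eΛ ⟨e.symm x', h₀⟩) = ζ' ⟨x', h'⟩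
      congr 1
      exact Subtype.ext (e.apply_symm_apply x')
    · have h₀ : e.symm x' ∉ Λ := fun h => h' (by rw [hΛ', Finset.mem_map_equiv]; exact h)
      rw [glueWith_apply_not_mem _ _ _ h₀, glueWith_apply_not_mem _ _ _ h', arrowCongr'_refl_apply]
  have hS : ∀ ζ' : ↥Λ' → G, φ (glueWith Λ (Ψ.symm ζ') η) = φ' (glueWith Λ' ζ' (T η)) := fun ζ' => by
    rw [← hglue]
    exact (hcov _).symm
  rw [integral_tilted_glueWith φ' hφc' Λ' hF,
    integral_tilted_glueWith φ hφc Λ (F := fun U => F (T U)) (hF.comp T.measurable),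
    ← hΨm.integral_comp', ← hΨm.integral_comp']
  simp only [hglue, hS]

/-- **Covariance of tilted product-Haar kernels under a relabelling of the links (push-forward form)**. [folklore] -/
theorem tilted_glueWith_map_arrowCongr (φ φ' : LGConfig d G → ℝ) (hφc : Continuous φ) (hφc' : Continuous φ')
    (Λ : Finset (ZdEdge d)) (e : ZdEdge d ≃ ZdEdge d)
    (hcov : ∀ U, φ' (MeasurableEquiv.arrowCongr' e (MeasurableEquiv.refl G) U) = φ U) (η : LGConfig d G) :
    (((Measure.pi fun _ : ↥Λ => haarProbability G).map (glueWith Λ · η)).tilted φ).map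
        (MeasurableEquiv.arrowCongr' e (MeasurableEquiv.refl G)) =
      ((Measure.pi fun _ : ↥(Λ.map e.toEmbedding) => haarProbability G).map
        (glueWith (Λ.map e.toEmbedding) · (MeasurableEquiv.arrowCongr' e (MeasurableEquiv.refl G) η))).tilted φ' := by
  set T := MeasurableEquiv.arrowCongr' e (MeasurableEquiv.refl G) with hT
  set Λ' := Λ.map e.toEmbedding with hΛ'
  haveI h1 : IsProbabilityMeasure (((Measure.pi fun _ : ↥Λ => haarProbability G).map (glueWith Λ · η)).tilted φ) :=
    isProbabilityMeasure_tilted_map_glueWith_pi (V := ZdEdge d) (haarProbability G) Λ η hφc.measurable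
      (exists_bound_of_continuous hφc)
  haveI h2 : IsProbabilityMeasure (((Measure.pi fun _ : ↥Λ' => haarProbability G).map
      (glueWith Λ' · (T η))).tilted φ') :=
    isProbabilityMeasure_tilted_map_glueWith_pi (V := ZdEdge d) (haarProbability G) Λ' (T η)
      hφc'.measurable (exists_bound_of_continuous hφc')
  haveI : IsProbabilityMeasure ((((Measure.pi fun _ : ↥Λ => haarProbability G).map (glueWith Λ · η)).tilted φ).map T) :=
    Measure.isProbabilityMeasure_map T.measurable.aemeasurable
  ext A hA
  have hind : Measurable (A.indicator (1 : LGConfig d G → ℝ)) := measurable_one.indicator hA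
  have h1' : ((((Measure.pi fun _ : ↥Λ => haarProbability G).map (glueWith Λ · η)).tilted φ).map T).real A =
      (((Measure.pi fun _ : ↥Λ' => haarProbability G).map (glueWith Λ' · (T η))).tilted φ').real A := by
    rw [← integral_indicator_one hA, ← integral_indicator_one hA, integral_map_equiv,
      integral_tilted_glueWith_arrowCongr φ φ' hφc hφc' Λ e hcov hind η]
  rw [measureReal_def, measureReal_def, ENNReal.toReal_eq_toReal_iff' (measure_ne_top _ _)
    (measure_ne_top _ _)] at h1'
  exact h1'

end Tilted

end Covariance

/-! ### Axis permutations: plaquettes and the boundary Wilson action -/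

section AxisPerm

variable {d : ℕ}

/-- The links of the plaquette `(π x; π a, π b)` (`π a < π b`) are the permuted links of `(x; a, b)`. [folklore] -/
theorem plaquetteEdges_perm_of_lt (π : Equiv.Perm (Fin d)) (x : Site d) {a b : Fin d} (hab : a < b) (h : π a < π b) :
    plaquetteEdges ((sitePermZd π x, ⟨(π a, π b), h⟩) : ZdPlaquette d) =
      (plaquetteEdges ((x, ⟨(a, b), hab⟩) : ZdPlaquette d)).map (edgePermZd π).toEmbedding := by
  simp only [plaquetteEdges, Finset.map_insert, Finset.map_singleton, Equiv.coe_toEmbedding, edgePermZd,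
    Equiv.prodCongr_apply, Prod.map, sitePermZd_add, sitePermZd_single]

/-- The links of the plaquette `(π x; π b, π a)` (`π b < π a`) are the permuted links of `(x; a, b)` (same set, other plane
orientation). [folklore] -/
theorem plaquetteEdges_perm_of_gt (π : Equiv.Perm (Fin d)) (x : Site d) {a b : Fin d} (hab : a < b) (h : π b < π a) :
    plaquetteEdges ((sitePermZd π x, ⟨(π b, π a), h⟩) : ZdPlaquette d) =
      (plaquetteEdges ((x, ⟨(a, b), hab⟩) : ZdPlaquette d)).map (edgePermZd π).toEmbedding := by
  ext y
  simp only [plaquetteEdges, Finset.map_insert, Finset.map_singleton, Equiv.coe_toEmbedding, edgePermZd,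
    Equiv.prodCongr_apply, Prod.map, sitePermZd_add, sitePermZd_single, Finset.mem_insert, Finset.mem_singleton]
  tauto

variable {N : ℕ} {G : Type*} [Group G] [TopologicalSpace G] [IsTopologicalGroup G] [CompactSpace G]
  [MeasurableSpace G] (ρ : G →* Matrix (Fin N) (Fin N) ℂ)

/-- **A permuted plaquette is a plaquette with the same observable**: `p'` has links `edgePermZd π '' links(p)` and
`Re tr ρ(U'_{p'}) = Re tr ρ(U_p)` for `U' = configPermZd π U` (orientation immaterial: `plaquetteObs_swap`). [folklore] -/
theorem exists_plaquette_perm (hρ : Continuous ρ) (π : Equiv.Perm (Fin d)) (p : ZdPlaquette d) :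
    ∃ p' : ZdPlaquette d, plaquetteEdges p' = (plaquetteEdges p).map (edgePermZd π).toEmbedding ∧
      ∀ U : LGConfig d G, plaquetteObs ρ p'.1 p'.2.1.1 p'.2.1.2 (configPermZd π U) = plaquetteObs ρ p.1 p.2.1.1 p.2.1.2 U := by
  obtain ⟨x, ⟨⟨a, b⟩, hab⟩⟩ := p
  have hab' : a < b := hab
  by_cases h : π a < π b
  · refine ⟨(sitePermZd π x, ⟨(π a, π b), h⟩), plaquetteEdges_perm_of_lt π x hab' h, fun U => ?_⟩
    simp only [plaquetteObs_configPermZd, sitePermZd_symm_apply_apply, Equiv.symm_apply_apply]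
  · have h' : π b < π a := lt_of_le_of_ne (not_lt.1 h) fun heq => hab'.ne' (π.injective heq)
    refine ⟨(sitePermZd π x, ⟨(π b, π a), h'⟩), plaquetteEdges_perm_of_gt π x hab' h', fun U => ?_⟩
    simp only [plaquetteObs_configPermZd, sitePermZd_symm_apply_apply, Equiv.symm_apply_apply]
    exact plaquetteObs_swap ρ hρ x a b U

/-- **The boundary Wilson action on `ℤ^d` is covariant under permutations of the axes**: `S_{πΛ}(configPermZd π U) = S_Λ(U)`
(re-index the plaquettes by `exists_plaquette_perm`; a plaquette is determined by its links). [folklore] -/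
theorem wilsonBoundaryAction_perm (hρ : Continuous ρ) (π : Equiv.Perm (Fin d)) (Λ : Finset (ZdEdge d)) (U : LGConfig d G) :
    wilsonBoundaryAction ρ (Λ.map (edgePermZd π).toEmbedding) (configPermZd π U) = wilsonBoundaryAction ρ Λ U := by
  classical
  -- the forward and backward re-indexing of plaquettes
  choose f hf hfo using exists_plaquette_perm ρ hρ π
  choose g hg _hgo using exists_plaquette_perm ρ hρ π.symm
  have hπinv : (edgePermZd (d := d) π.symm) = (edgePermZd π).symm := rfl
  have hgf : ∀ p, g (f p) = p := fun p =>
    plaquetteEdges_injective (by rw [hg, hf, hπinv, Covariance.map_map_symm])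
  have hfg : ∀ p, f (g p) = p := fun p =>
    plaquetteEdges_injective (by rw [hf, hg, hπinv, Covariance.map_symm_map])
  have hmem : ∀ p, p ∈ plaquettesTouching Λ ↔ f p ∈ plaquettesTouching (Λ.map (edgePermZd π).toEmbedding) := fun p => by
    rw [mem_plaquettesTouching_iff, mem_plaquettesTouching_iff, hf, ← Finset.map_inter, Finset.map_nonempty]
  unfold wilsonBoundaryAction
  refine (Finset.sum_nbij' f g (fun p hp => (hmem p).1 hp) (fun p hp => ?_) (fun p _ => hgf p) (fun p _ => hfg p)
    (fun p _ => by rw [hfo])).symm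
  rw [hmem, hfg]
  exact hp

end AxisPerm

section Carriers

variable {d N : ℕ} {G : Type*} [Group G] (ρ : G →* Matrix (Fin N) (Fin N) ℂ)

variable [TopologicalSpace G] [IsTopologicalGroup G] [CompactSpace G] [MeasurableSpace G] [BorelSpace G]
  [SecondCountableTopology G]

/-- ★ **Axis-permutation covariance of the tier-1 perturbed specification**: if the member's finite-volume Hamiltonians
are permutation covariant, `H^W_{πΛ}(configPermZd π U) = H^W_Λ(U)`, then
`γ^W_Λ(· | η) ∘ (configPermZd π)⁻¹ = γ^W_{πΛ}(· | configPermZd π η)`. [folklore] -/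
theorem perturbedYM_map_configPermZd (hρ : Continuous ρ) (β : ℝ) {W : Potential (ZdEdge d) G}
    (hWc : ∀ X, Continuous (W X)) (supp : Finset (ZdEdge d) → Finset (Finset (ZdEdge d)))
    (Λ : Finset (ZdEdge d)) (π : Equiv.Perm (Fin d))
    (hH : ∀ U : LGConfig d G,
      hamiltonianIn W supp (Λ.map (edgePermZd π).toEmbedding) (configPermZd π U) = hamiltonianIn W supp Λ U)
    (η : LGConfig d G) :
    (perturbedYM ρ β W supp Λ η).map (configPermZd π) =
      perturbedYM ρ β W supp (Λ.map (edgePermZd π).toEmbedding) (configPermZd π η) := by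
  have hcov : ∀ U : LGConfig d G, perturbedEnergy ρ β W supp (Λ.map (edgePermZd π).toEmbedding) (configPermZd π U) =
      perturbedEnergy ρ β W supp Λ U := fun U => by
    simp only [perturbedEnergy, wilsonBoundaryAction_perm ρ hρ, hH]
  exact Covariance.tilted_glueWith_map_arrowCongr _ _ (continuous_perturbedEnergy ρ hρ β hWc supp Λ)
    (continuous_perturbedEnergy ρ hρ β hWc supp _) Λ (edgePermZd π) hcov η

/-- ★ **Tier 1: the image of a DLR state of an axis-symmetric member under an axis permutation is a DLR state.**
[folklore] -/
theorem map_configPermZd_mem_perturbedGibbsMeasures [T2Space G] (hρ : Continuous ρ) (β : ℝ)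
    {W : Potential (ZdEdge d) G} (hWc : ∀ X, Continuous (W X)) (hdep : ∀ X, DependsOn (W X) (↑X : Set (ZdEdge d)))
    {supp : Finset (ZdEdge d) → Finset (Finset (ZdEdge d))} (hsupp : W.IsSupportedBy supp)
    (hH : ∀ (Λ : Finset (ZdEdge d)) (π : Equiv.Perm (Fin d)) (U : LGConfig d G),
      hamiltonianIn W supp (Λ.map (edgePermZd π).toEmbedding) (configPermZd π U) = hamiltonianIn W supp Λ U)
    {μ : Measure (LGConfig d G)} (hμ : μ ∈ perturbedGibbsMeasures (d := d) ρ β W supp) (π : Equiv.Perm (Fin d)) :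
    μ.map (configPermZd π) ∈ perturbedGibbsMeasures (d := d) ρ β W supp :=
  Covariance.map_arrowCongr_mem_gibbsMeasures
    (isSpecification_perturbedYM ρ hρ β (fun X => ⟨hdep X, (hWc X).measurable⟩)
      (fun X => exists_bound_of_continuous (hWc X)) hsupp)
    (edgePermZd π) (fun Λ η => perturbedYM_map_configPermZd ρ hρ β hWc supp Λ π (hH Λ π) η) hμ

end Carriers

section Currencies

variable {d N : ℕ}

/-- ★★ **TIER 1: THE ONE STATE OF AN AXIS-SYMMETRIC MEMBER IS AXIS-SYMMETRIC.** Under `PerturbedMassGapAt d N β W supp`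
(continuous terms reading their own links, locally finite support) and permutation covariance of the finite-volume
Hamiltonians, the one DLR state `μ` satisfies `μ ∘ (configPermZd π)⁻¹ = μ` for every permutation `π` of the axes.
[folklore] -/
theorem oneState_permInvariant_of_perturbedMassGapAt {β : ℝ} {W : Potential (ZdEdge d) (SUN N)}
    {supp : Finset (ZdEdge d) → Finset (Finset (ZdEdge d))} (hgap : PerturbedMassGapAt d N β W supp)
    (hWc : ∀ X, Continuous (W X)) (hdep : ∀ X, DependsOn (W X) (↑X : Set (ZdEdge d)))
    (hsupp : W.IsSupportedBy supp)
    (hH : ∀ (Λ : Finset (ZdEdge d)) (π : Equiv.Perm (Fin d)) (U : LGConfig d (SUN N)),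
      hamiltonianIn W supp (Λ.map (edgePermZd π).toEmbedding) (configPermZd π U) = hamiltonianIn W supp Λ U) :
    ∃ μ : Measure (LGConfig d (SUN N)),
      perturbedGibbsMeasures (d := d) (fundamentalRep (Fin N)) ((N : ℝ) * β) W supp = {μ} ∧
        ∀ π : Equiv.Perm (Fin d), μ.map (configPermZd π) = μ := by
  obtain ⟨hsub, ⟨μ, hμ⟩⟩ := hgap.1
  exact ⟨μ, Set.eq_singleton_iff_unique_mem.2 ⟨hμ, fun ν hν => hsub hν hμ⟩, fun π =>
    hsub (map_configPermZd_mem_perturbedGibbsMeasures _ (continuous_fundamentalRep (Fin N)) _ hWc hdep hsupp hH hμ π) hμ⟩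

/-- ★★ **WILSON ACTION (every `d`, `N`; DLR side, no torus limit): under `MassGapAt d N β` the unique DLR state is invariant under
every permutation of the axes** (kernel covariance `perturbedYM_map_configPermZd` at `W = 0`). [folklore] -/
theorem oneState_permInvariant_of_massGapAt {β : ℝ} (hgap : MassGapAt d N β) :
    ∃ μ : Measure (LGConfig d (SUN N)),
      ymGibbsMeasures (d := d) (fundamentalRep (Fin N)) ((N : ℝ) * β) = {μ} ∧
        ∀ π : Equiv.Perm (Fin d), μ.map (configPermZd π) = μ := by
  have h0 : PerturbedMassGapAt d N β 0 (fun _ => ∅) := (perturbedMassGapAt_zero_iff β _).2 hgap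
  obtain ⟨μ, hG, hP⟩ := oneState_permInvariant_of_perturbedMassGapAt h0 (fun _ => continuous_const)
    (fun _ _ _ _ => rfl) (fun _ _ _ h => (h rfl).elim) (fun Λ π U => by simp [hamiltonianIn])
  refine ⟨μ, ?_, hP⟩
  rwa [perturbedGibbsMeasures_zero] at hG

end Currencies

section Adjoint

variable {d N : ℕ}

/-- The permuted links of a plaquette are the links of a plaquette, and conversely. [folklore] -/
theorem exists_plaquetteEdges_eq_map_perm_iff (π : Equiv.Perm (Fin d)) (X : Finset (ZdEdge d)) :
    (∃ p : ZdPlaquette d, plaquetteEdges p = X.map (edgePermZd π).toEmbedding) ↔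
      ∃ p : ZdPlaquette d, plaquetteEdges p = X := by
  have hπinv : (edgePermZd (d := d) π.symm) = (edgePermZd π).symm := rfl
  constructor
  · rintro ⟨p, hp⟩
    obtain ⟨p', hp', -⟩ :=
      exists_plaquette_perm (G := SUN 1) (fundamentalRep (Fin 1)) (continuous_fundamentalRep (Fin 1)) π.symm p
    refine ⟨p', ?_⟩
    rw [hp', hp, hπinv, Covariance.map_map_symm]
  · rintro ⟨p, hp⟩
    obtain ⟨p', hp', -⟩ := exists_plaquette_perm (G := SUN 1) (fundamentalRep (Fin 1)) (continuous_fundamentalRep (Fin 1)) π p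
    exact ⟨p', by rw [hp', hp]⟩

/-- **The plaquette support family is permutation covariant.** [folklore] -/
theorem plaquetteSupp_perm (π : Equiv.Perm (Fin d)) (Λ : Finset (ZdEdge d)) :
    plaquetteSupp (Λ.map (edgePermZd π).toEmbedding) =
      (plaquetteSupp Λ).map (Equiv.finsetCongr (edgePermZd π)).toEmbedding := by
  classical
  have hπinv : (edgePermZd (d := d) π.symm) = (edgePermZd π).symm := rfl
  ext X
  simp only [plaquetteSupp, Finset.mem_image, Finset.mem_map, Equiv.coe_toEmbedding, Equiv.finsetCongr_apply,
    mem_plaquettesTouching_iff]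
  constructor
  · rintro ⟨p, hp, rfl⟩
    obtain ⟨q, hq, -⟩ :=
      exists_plaquette_perm (G := SUN 1) (fundamentalRep (Fin 1)) (continuous_fundamentalRep (Fin 1)) π.symm p
    rw [hπinv] at hq
    refine ⟨plaquetteEdges q, ⟨q, ?_, rfl⟩, ?_⟩
    · rw [hq, ← Covariance.map_map_symm (edgePermZd π) Λ, ← Finset.map_inter, Finset.map_nonempty]
      exact hp
    · rw [hq, Covariance.map_symm_map]
  · rintro ⟨Y, ⟨q, hq, rfl⟩, rfl⟩
    obtain ⟨p, hp, -⟩ := exists_plaquette_perm (G := SUN 1) (fundamentalRep (Fin 1)) (continuous_fundamentalRep (Fin 1)) π q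
    refine ⟨p, ?_, hp⟩
    rw [hp, ← Finset.map_inter, Finset.map_nonempty]
    exact hq

/-- **The adjoint-plaquette witness is permutation covariant**: `W_{πX}(configPermZd π U) = W_X(U)`. [folklore] -/
theorem adjointWitness_perm (t : ℝ) (π : Equiv.Perm (Fin d)) (X : Finset (ZdEdge d))
    (U : LGConfig d (Matrix.specialUnitaryGroup (Fin N) ℂ)) :
    adjointWitness (N := N) t (X.map (edgePermZd π).toEmbedding) (configPermZd π U) = adjointWitness t X U := by
  unfold adjointWitness
  by_cases h : ∃ p : ZdPlaquette d, plaquetteEdges p = X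
  · have h' : ∃ p : ZdPlaquette d, plaquetteEdges p = X.map (edgePermZd π).toEmbedding :=
      (exists_plaquetteEdges_eq_map_perm_iff π X).2 h
    rw [dif_pos h', dif_pos h]
    set p := Classical.choose h with hp
    set p' := Classical.choose h' with hp'
    have hpX : plaquetteEdges p = X := Classical.choose_spec h
    have hp'X : plaquetteEdges p' = X.map (edgePermZd π).toEmbedding := Classical.choose_spec h'
    obtain ⟨q, hq, hqo⟩ := exists_plaquette_perm (fundamentalRep (Fin N)) (continuous_fundamentalRep (Fin N)) π p
    have hpp : p' = q := plaquetteEdges_injective (by rw [hp'X, hq, hpX])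
    rw [hpp, hqo]
  · have h' : ¬ ∃ p : ZdPlaquette d, plaquetteEdges p = X.map (edgePermZd π).toEmbedding :=
      fun h'' => h ((exists_plaquetteEdges_eq_map_perm_iff π X).1 h'')
    rw [dif_neg h', dif_neg h]

/-- **The finite-volume Hamiltonians of the adjoint-plaquette witness are permutation covariant.** [folklore] -/
theorem hamiltonianIn_adjointWitness_perm (t : ℝ) (Λ : Finset (ZdEdge d)) (π : Equiv.Perm (Fin d))
    (U : LGConfig d (Matrix.specialUnitaryGroup (Fin N) ℂ)) :
    hamiltonianIn (adjointWitness (N := N) t) plaquetteSupp (Λ.map (edgePermZd π).toEmbedding) (configPermZd π U) =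
      hamiltonianIn (adjointWitness t) plaquetteSupp Λ U := by
  classical
  simp only [hamiltonianIn, plaquetteSupp_perm, Finset.filter_map, Finset.sum_map]
  refine Finset.sum_congr ?_ fun X _ => ?_
  · congr 1
    ext X
    simp only [Function.comp_apply, Equiv.coe_toEmbedding, Equiv.finsetCongr_apply, ← Finset.map_inter,
      Finset.map_nonempty]
  · rw [Equiv.coe_toEmbedding, Equiv.finsetCongr_apply, adjointWitness_perm]

/-- ★ **THE `SU(2)` BHANOT–CREUTZ MIXED ACTION at `β_W = 1/8`, `|t| ≤ 1/100`: ONE STATE, INVARIANT UNDER ALL `24` PERMUTATIONS OF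
THE AXES** (on top of its translation invariance, `su2_mixedAction_oneState_translationInvariant`). [folklore] -/
theorem su2_mixedAction_oneState_permInvariant {t : ℝ} (ht : |t| ≤ 1 / 100) :
    ∃ μ : Measure (LGConfig 4 (SUN 2)),
      perturbedGibbsMeasures (d := 4) (fundamentalRep (Fin 2)) (((2 : ℕ) : ℝ) * ((1 / 8 : ℝ) / 4))
          (adjointWitness t) plaquetteSupp = {μ} ∧ ∀ π : Equiv.Perm (Fin 4), μ.map (configPermZd π) = μ :=
  oneState_permInvariant_of_perturbedMassGapAt (su2_mixedAction_massGap_1_8 ht)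
    (continuous_adjointWitness t) (dependsOn_adjointWitness t) (isSupportedBy_adjointWitness t)
    (fun Λ π U => hamiltonianIn_adjointWitness_perm t Λ π U)

end Adjoint

end Summit.Ventures.YMGap.RobustBall

end
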